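import Mathlib
import Summits.QuantumFields.YangMills.Theorems.BalabanUVNodesN15BackgroundGaugeSpeciesMatrix
import Summits.QuantumFields.YangMills.Theorems.BalabanUVNodesN15BackgroundV1Coefficients
import HarnessLib

/-!
# Route «BalabanUVNodes» (cluster K4 «SpineRates»), Track-A DAG node N15 = spine estimate NE2, BACKGROUND LAYER — THE PRINT's OWN FIRST-ORDER PERTURBATION
# `V′₁(A)` OF (3.52) AS A DIAGONAL SPECIES ON THE FORWARD∕BACKWARD STACK: the carrier of its three input fields `(A⁺, A⁻, W)` (forward bond field, backward bond
# field, covariant divergence) with the (3.35) letter pair on each, the transport, the instances, and M1's three perturbation letters DISCHARGED from (3.35)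

Cell `pub-ymgap`, seat `pub-ymgap-dag-n15-c` (generation g2; R134 ACCELERATION SEAT, strategy s1; HUMAN RULING D-0062; chair R424 venue).  `bears_on: R4∕N15`.
Filed `--supports stmt-QuantumFields-19676` (K3; helper).  Imports BY NAME, nothing in the tree modified: this seat's G1 `…N15BackgroundGaugeSpeciesMatrix` (through it
M1 `unstackM`, `hasMaj_unstackM`, `hasMaj_idef_unstackM`, A1∕A2 `fineGeo`, `abs_le_iSup_abs`, g0's `opGeo`, 13c `blockAvgV`, `fit_blockAvgV`, `norm_blockAvgV_le`) and
`…N15BackgroundV1Coefficients` (`v1coefC`, `v1coefA`, `rowSum_v1coefC_le`, `rowSum_v1coefA_le`, `rowFit_v1coefC`, `rowFit_v1coefA`).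

THE POINT (see `…N15BackgroundV1Coefficients` for the derivation).  In the `U ≡ 1` background the print's `V′₁(A)` ([Balaban1985BackgroundPropagators] (3.52) p. 400)
is `M_c + Σ_μ [M_{a⁺_μ}∘∇⁺_μ + M_{a⁻_μ}∘∇⁻_μ]` — DIAGONAL on the forward∕backward stack `J ⊕ J`, so B1a∕M1's pair `X̂ = (1 − ĜV̂)⁻¹Ĝ` and this seat's species-independent
`hasMaj_entries_of_letters` apply VERBATIM once the three perturbation letters are produced.  THIS FILE: the carrier `v1Bg` (configurations
`U = (A⁺, A⁻, W) : (J → X′ → 𝔄)² × (X′ → 𝔄)`, `Reg335` = the (3.35) letter pair — sup in the norm of `𝔄`, fibrewise oscillation — on each field; `v1fieldsOfGauge` records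
how the three arise from ONE gauge field on a lattice with unit shifts), the transport `v1avg` (fibrewise means, linearised (C3)), the pairing ∕ instance on the
product carrier `X × ι`, and **`v1_letters_of_reg335`**: under the guard (`M ≥ 1`, `M·α₀ ≤ a₀`, `2c₃₅a₀ ≤ 1`, `η′ ≤ η ≤ min(1, θ)`) M1's three letters for
`unstackM (v1coefC …) (v1coefA …)` with ONE constant `r₂ = 16e(1+|J|)κ_e·c₃₅Mα₀`.  The by-name readout (`NE2PlusOperator` with `V′₁(A)` live) is the sequel.

CONTENTS ([folklore]; 6 defs).  `v1Bg`, `reg335_v1Bg_iff`, `v1fieldsOfGauge`, `v1avg`, `v1avg_zero`, `v1Pairing`, `v1Instance`, `v1Instance_M`; **`v1_letters_of_reg335`**.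

HONEST FRAMING ∕ LIMITS.  SHAPES of (3.52) in the `U ≡ 1` background; `𝔤 ↦ 𝔄` with coordinates; the three fields carried INDEPENDENTLY (their joint origin in one
`A′` is a def, not a constraint) and transported by fibrewise means — NOT the (C3) nonlinear average; the averaging-operator perturbation `V′₂` of (3.55)–(3.62) NOT
typed; crude constants.  NE2⁺ NOT PRINTED, NOT proved; count-neutral (typed 28∕28; nothing discharged); N15 NOT discharged; one finite lattice at fixed ε — NOT
infinite volume, NOT OS on ℝ⁴, NOT a mass gap, NOT Clay.
-/

noncomputable section

open scoped BigOperators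

namespace Summit.QuantumFields.YangMills.BalabanUVNodes.N15.BackgroundLayer

open Literature.MathematicalPhysics.QuantumFieldTheory.Balaban1983to89
open Literature.MathematicalPhysics.QuantumFieldTheory.Balaban1983to89.B11SectG (BlockNorm HasMaj)
open Literature.MathematicalPhysics.QuantumFieldTheory.Balaban1983to89.T4EtaRate (PairedInstance EtaPairing)
open Literature.MathematicalPhysics.QuantumFieldTheory.Balaban1983to89.T4EtaRateDefect (idef)
open Literature.MathematicalPhysics.QuantumFieldTheory.Balaban1983to89.T4EtaRateCoeffDefect (pull diagK)
open Summit.QuantumFields.YangMills.BalabanUVNodes.N15.OperatorReadout (opGeo)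
open Summit.QuantumFields.YangMills.BalabanUVNodes.N15.MatrixSpecies (liftMap liftBlk basisConst basisConst_nonneg blockAvgV fit_blockAvgV norm_blockAvgV_le)

/-! ## §3 The carrier of the three fields, the transport, the instances -/

section Carrier

variable {X X' : Type} (𝔄 J : Type) [NormedAddCommGroup 𝔄] [NormedSpace ℝ 𝔄]

/-- THE CARRIER OF `V′₁(A)`'s INPUT FIELDS: configurations `U = (A⁺, A⁻, W)` — forward bond field, backward bond field (`J → X′ → 𝔄`), covariant divergence (`X′ → 𝔄`)
— `one := 0`, `mul := (+)`, and `Reg335 c α₀ U` = THE (3.35) LETTER PAIR IN THE NORM OF `𝔄` on each of the three fields: sup `≤ c·M·α₀`, fibrewise oscillation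
`≤ c·M·α₀·θ`; `Reg336` repeats it; (3.37)–(3.38) inert. [cite: Balaban1985BackgroundPropagators, (3.35) p.396 («|A|, |∇^ηA|» on □: shape); (3.52) p.400 (the three coefficient fields: shape)] -/
def v1Bg (π : X' → X) (M θ : ℝ) : B9.Backgrounds where
  Cfg := (J → X' → 𝔄) × (J → X' → 𝔄) × (X' → 𝔄)
  one := 0
  mul := fun U₁ U₂ => U₁ + U₂
  Reg335 := fun c α₀ U => ((∀ μ x', ‖U.1 μ x'‖ ≤ c * M * α₀) ∧ (∀ μ x', ‖U.2.1 μ x'‖ ≤ c * M * α₀) ∧ ∀ x', ‖U.2.2 x'‖ ≤ c * M * α₀) ∧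
    ((∀ μ x₁' x₂', π x₁' = π x₂' → ‖U.1 μ x₁' - U.1 μ x₂'‖ ≤ c * M * α₀ * θ) ∧
      (∀ μ x₁' x₂', π x₁' = π x₂' → ‖U.2.1 μ x₁' - U.2.1 μ x₂'‖ ≤ c * M * α₀ * θ) ∧
        ∀ x₁' x₂', π x₁' = π x₂' → ‖U.2.2 x₁' - U.2.2 x₂'‖ ≤ c * M * α₀ * θ)
  Reg336 := fun c α₀ U => ((∀ μ x', ‖U.1 μ x'‖ ≤ c * M * α₀) ∧ (∀ μ x', ‖U.2.1 μ x'‖ ≤ c * M * α₀) ∧ ∀ x', ‖U.2.2 x'‖ ≤ c * M * α₀) ∧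
    ((∀ μ x₁' x₂', π x₁' = π x₂' → ‖U.1 μ x₁' - U.1 μ x₂'‖ ≤ c * M * α₀ * θ) ∧
      (∀ μ x₁' x₂', π x₁' = π x₂' → ‖U.2.1 μ x₁' - U.2.1 μ x₂'‖ ≤ c * M * α₀ * θ) ∧
        ∀ x₁' x₂', π x₁' = π x₂' → ‖U.2.2 x₁' - U.2.2 x₂'‖ ≤ c * M * α₀ * θ)
  Cplx337 := fun _ _ _ => True
  Cplx338 := fun _ _ _ => True

omit [NormedSpace ℝ 𝔄] in
/-- Unfolding of the carrier's (3.35). [folklore] -/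
theorem reg335_v1Bg_iff (π : X' → X) (M θ c α₀ : ℝ) (U : (J → X' → 𝔄) × (J → X' → 𝔄) × (X' → 𝔄)) :
    (v1Bg 𝔄 J π M θ).Reg335 c α₀ U ↔
      ((∀ μ x', ‖U.1 μ x'‖ ≤ c * M * α₀) ∧ (∀ μ x', ‖U.2.1 μ x'‖ ≤ c * M * α₀) ∧ ∀ x', ‖U.2.2 x'‖ ≤ c * M * α₀) ∧
      ((∀ μ x₁' x₂', π x₁' = π x₂' → ‖U.1 μ x₁' - U.1 μ x₂'‖ ≤ c * M * α₀ * θ) ∧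
        (∀ μ x₁' x₂', π x₁' = π x₂' → ‖U.2.1 μ x₁' - U.2.1 μ x₂'‖ ≤ c * M * α₀ * θ) ∧
          ∀ x₁' x₂', π x₁' = π x₂' → ‖U.2.2 x₁' - U.2.2 x₂'‖ ≤ c * M * α₀ * θ) := Iff.rfl

variable [Fintype J] in
/-- HOW THE THREE FIELDS ARISE FROM ONE GAUGE FIELD `A′ : J → X′ → 𝔄` on a lattice with unit shifts `s_μ : X′ ≃ X′` and spacing `η′`: `A⁺_μ = A′_μ`,
`A⁻_μ = A′_μ(· − e_μ)`, `W = Σ_μ η′⁻¹(A′_μ − A′_μ(· − e_μ))` (the `U ≡ 1` covariant divergence).  The carrier transports the three INDEPENDENTLY (shape).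
[cite: Balaban1985BackgroundPropagators, (3.50)–(3.52) p.400 (shape)] -/
def v1fieldsOfGauge (s : J → X' ≃ X') (η' : ℝ) (A' : J → X' → 𝔄) : (J → X' → 𝔄) × (J → X' → 𝔄) × (X' → 𝔄) :=
  (A', fun μ x' => A' μ ((s μ).symm x'), fun x' => ∑ μ, η'⁻¹ • (A' μ x' - A' μ ((s μ).symm x')))

variable [Fintype X'] [DecidableEq X]

/-- THE TRANSPORT: fibrewise means of each of the three fields (13c `blockAvgV`; linearised (C3)). [folklore] -/
def v1avg (π : X' → X) (U : (J → X' → 𝔄) × (J → X' → 𝔄) × (X' → 𝔄)) : (J → X → 𝔄) × (J → X → 𝔄) × (X → 𝔄) :=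
  (fun μ => blockAvgV π (U.1 μ), fun μ => blockAvgV π (U.2.1 μ), blockAvgV π U.2.2)

/-- `avg_one`. [folklore] -/
theorem v1avg_zero (π : X' → X) : v1avg 𝔄 J π (0 : (J → X' → 𝔄) × (J → X' → 𝔄) × (X' → 𝔄)) = 0 := by
  refine Prod.ext (funext fun μ => funext fun x => ?_) (Prod.ext (funext fun μ => funext fun x => ?_) (funext fun x => ?_)) <;>
    simp [v1avg, blockAvgV]

variable {g : B6.Geometry} [Fintype X] (ι : Type) [Fintype ι]

/-- THE η-PAIRING over the `V′₁` carriers on the product carrier `X × ι` (NOT PRINTED data; shape of G1's `gaugePairingM`). [cite: King1986, p.664 (convention before Prop. 3.8)] -/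
def v1Pairing (blk : X → g.Site) (π : X' → X) (n : ℕ) (hL : g.L ≠ 0) (θc θ : ℝ) :
    EtaPairing (opGeo g (X × ι) (liftBlk blk ι)) (fineGeo g (X' × ι) (liftBlk (blk ∘ π) ι) n) (v1Bg 𝔄 J (fun x : X => x) g.M θc)
      (v1Bg 𝔄 J π g.M θ) where
  n := n
  k_eq := rfl
  L_eq := rfl
  M_eq := rfl
  eta_eq := by
    show g.eta * (g.L ^ n)⁻¹ * g.L ^ n = g.eta
    rw [mul_assoc, inv_mul_cancel₀ (pow_ne_zero _ hL), mul_one]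
  ι := fun y => y
  scale_ι := fun _ => rfl
  dist_ι := fun _ _ => rfl
  τ := fun lam => pull (liftMap π ι) lam
  suppIn_τ := fun _ _ h p hp => h (liftMap π ι p) hp
  supNorm_τ := fun lam => by
    show (⨆ p : X' × ι, |lam (liftMap π ι p)|) ≤ ⨆ p : X × ι, |lam p|
    exact Real.iSup_le (fun p => abs_le_iSup_abs lam (liftMap π ι p)) (Real.iSup_nonneg fun p => abs_nonneg _)
  avg := v1avg 𝔄 J π
  avg_one := v1avg_zero 𝔄 J π

/-- THE REALISED PAIRED INSTANCE over the `V′₁` carriers. [cite: Balaban1985BackgroundPropagators, Thm 3.14 pp.426–427 (typing template)] -/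
def v1Instance (blk : X → g.Site) (π : X' → X) (n : ℕ) (hL : g.L ≠ 0) (θc θ : ℝ) : PairedInstance :=
  ⟨opGeo g (X × ι) (liftBlk blk ι), fineGeo g (X' × ι) (liftBlk (blk ∘ π) ι) n, v1Bg 𝔄 J (fun x : X => x) g.M θc, v1Bg 𝔄 J π g.M θ,
    v1Pairing 𝔄 J ι blk π n hL θc θ⟩

/-- THE GUARD IS LIVE. [folklore] -/
theorem v1Instance_M (blk : X → g.Site) (π : X' → X) (n : ℕ) (hL : g.L ≠ 0) (θc θ : ℝ) : (v1Instance 𝔄 J ι blk π n hL θc θ).gf.M = g.M := rfl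

end Carrier

/-! ## §4 M1's three perturbation letters for `V′₁(A)`, read off `Reg335` under the guard -/

section Letters

variable {X X' J ι : Type} [Fintype X] [Fintype X'] [Fintype J] [Fintype ι] [DecidableEq X] [DecidableEq ι] {𝔄 : Type} [NormedRing 𝔄]
  [NormedAlgebra ℝ 𝔄] [CompleteSpace 𝔄] (e : 𝔄 ≃L[ℝ] (ι → ℝ)) {g : B6.Geometry} (blk : X → g.Site) (π : X' → X)

/-- **THE THREE PERTURBATION LETTERS OF `V′₁(A)` FROM (3.35).**  Spacings `0 ≤ η′ ≤ η ≤ 1`, `η ≤ θ`; guard `c₃₅ > 0`, `M ≥ 1`, `α₀ > 0`, `M·α₀ ≤ a₀`, `2c₃₅a₀ ≤ 1`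
(the `ad` regime); `(v1Bg 𝔄 J π M θ).Reg335 c₃₅ α₀ U′`.  With `r₂ = 16e(1 + |J|)κ_e·c₃₅Mα₀`: the unstacked matrix perturbations of the coefficients of `V′₁` on the
forward∕backward stack `J ⊕ J` — fine `(v1coefC e η′ U′, v1coefA e η′ U′)`, coarse the same at `η` and the fibrewise-averaged fields `Ū = v1avg U′` — have majorants
`diagK (r₂(1+|J ⊕ J|))` and diagonal η-defect `diagK (r₂θ(1+|J ⊕ J|))`; `0 ≤ r₂ ≤ 16e(1+|J|)κ_e·c₃₅·a₀`.
[cite: Balaban1985BackgroundPropagators, Thm 3.1 p.397 (quantifier template); (3.35) p.396, (3.52) p.400 (shapes)] -/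
theorem v1_letters_of_reg335 {η η' θ c35 a₀ M α₀ : ℝ} (hη' : 0 ≤ η') (hη'η : η' ≤ η) (hη1 : η ≤ 1) (hηθ : η ≤ θ) (hc35 : 0 < c35)
    (hM : 1 ≤ M) (hα₀ : 0 < α₀) (hMα : M * α₀ ≤ a₀) (ha₀1 : 2 * (c35 * a₀) ≤ 1) {U' : (J → X' → 𝔄) × (J → X' → 𝔄) × (X' → 𝔄)}
    (hreg : (v1Bg 𝔄 J π M θ).Reg335 c35 α₀ U') :
    0 ≤ 16 * Real.exp 1 * (1 + Fintype.card J) * basisConst e * (c35 * M * α₀) ∧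
      16 * Real.exp 1 * (1 + Fintype.card J) * basisConst e * (c35 * M * α₀) ≤ 16 * Real.exp 1 * (1 + Fintype.card J) * basisConst e * c35 * a₀ ∧
      HasMaj (BlockNorm.ofBlocks g (blkPair (liftBlk blk ι))) (BlockNorm.ofBlocks g (liftBlk blk ι))
        (unstackM (v1coefC e η (v1avg 𝔄 J π U')) (v1coefA e η (v1avg 𝔄 J π U')))
        (diagK fun _ => 16 * Real.exp 1 * (1 + Fintype.card J) * basisConst e * (c35 * M * α₀) * (1 + Fintype.card (J ⊕ J))) ∧
      HasMaj (BlockNorm.ofBlocks g (blkPair (liftBlk (blk ∘ π) ι))) (BlockNorm.ofBlocks g (liftBlk (blk ∘ π) ι))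
        (unstackM (v1coefC e η' U') (v1coefA e η' U'))
        (diagK fun _ => 16 * Real.exp 1 * (1 + Fintype.card J) * basisConst e * (c35 * M * α₀) * (1 + Fintype.card (J ⊕ J))) ∧
      HasMaj (BlockNorm.ofBlocks g (blkPair (liftBlk blk ι))) (BlockNorm.ofBlocks g (liftBlk (blk ∘ π) ι))
        (idef (pull (liftPair (liftMap π ι))) (pull (liftMap π ι)) (unstackM (v1coefC e η' U') (v1coefA e η' U'))
          (unstackM (v1coefC e η (v1avg 𝔄 J π U')) (v1coefA e η (v1avg 𝔄 J π U'))))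
        (diagK fun _ => 16 * Real.exp 1 * (1 + Fintype.card J) * basisConst e * (c35 * M * α₀) * θ * (1 + Fintype.card (J ⊕ J))) := by
  obtain ⟨⟨hs₁, hs₂, hs₃⟩, ho₁, ho₂, ho₃⟩ := (reg335_v1Bg_iff 𝔄 J π M θ c35 α₀ U').1 hreg
  set r : ℝ := c35 * M * α₀ with hr_def
  have hκ : 0 ≤ basisConst e := basisConst_nonneg e
  have he : (1 : ℝ) ≤ Real.exp 1 := by have := Real.add_one_le_exp (1 : ℝ); linarith
  have hJ0 : (0 : ℝ) ≤ Fintype.card J := Nat.cast_nonneg _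
  have hJ1 : (1 : ℝ) ≤ 1 + Fintype.card J := le_add_of_nonneg_right hJ0
  have hM0 : 0 ≤ M := zero_le_one.trans hM
  have hr0 : 0 ≤ r := by positivity
  have hra : r ≤ c35 * a₀ := by rw [hr_def, mul_assoc]; exact mul_le_mul_of_nonneg_left hMα hc35.le
  have hr2 : 2 * r ≤ 1 := (mul_le_mul_of_nonneg_left hra zero_le_two).trans ha₀1
  have hη0 : 0 ≤ η := hη'.trans hη'η
  have hθ0 : 0 ≤ θ := hη0.trans hηθ
  -- coarse fields: fibrewise means stay in the box; fits from the oscillation letters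
  have hb₁ : ∀ μ x, ‖(v1avg 𝔄 J π U').1 μ x‖ ≤ r := fun μ x => norm_blockAvgV_le π hr0 (hs₁ μ) x
  have hb₂ : ∀ μ x, ‖(v1avg 𝔄 J π U').2.1 μ x‖ ≤ r := fun μ x => norm_blockAvgV_le π hr0 (hs₂ μ) x
  have hb₃ : ∀ x, ‖(v1avg 𝔄 J π U').2.2 x‖ ≤ r := fun x => norm_blockAvgV_le π hr0 hs₃ x
  have hf₁ : ∀ μ x', ‖U'.1 μ x' - (v1avg 𝔄 J π U').1 μ (π x')‖ ≤ r * θ := fun μ x' =>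
    fit_blockAvgV π (Ω := fun _ => r * θ) (fun x₁' x₂' h => ho₁ μ x₁' x₂' h) x'
  have hf₂ : ∀ μ x', ‖U'.2.1 μ x' - (v1avg 𝔄 J π U').2.1 μ (π x')‖ ≤ r * θ := fun μ x' =>
    fit_blockAvgV π (Ω := fun _ => r * θ) (fun x₁' x₂' h => ho₂ μ x₁' x₂' h) x'
  have hf₃ : ∀ x', ‖U'.2.2 x' - (v1avg 𝔄 J π U').2.2 (π x')‖ ≤ r * θ := fun x' =>
    fit_blockAvgV π (Ω := fun _ => r * θ) (fun x₁' x₂' h => ho₃ x₁' x₂' h) x'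
  -- the one letter
  set r₂ : ℝ := 16 * Real.exp 1 * (1 + Fintype.card J) * basisConst e * r with hr₂_def
  have hr₂0 : 0 ≤ r₂ := by positivity
  have hCr : 4 * Real.exp 1 * (1 + Fintype.card J) * basisConst e * r ≤ r₂ := by
    rw [hr₂_def]; nlinarith [mul_nonneg (mul_nonneg (zero_le_one.trans hJ1) hκ) hr0, Real.exp_nonneg (1 : ℝ)]
  have hAr : 4 * Real.exp 1 * basisConst e * r ≤ r₂ := by
    refine le_trans ?_ hCr
    have h0 : 0 ≤ 4 * Real.exp 1 * basisConst e * r := by positivity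
    calc 4 * Real.exp 1 * basisConst e * r = 1 * (4 * Real.exp 1 * basisConst e * r) := (one_mul _).symm
      _ ≤ (1 + Fintype.card J) * (4 * Real.exp 1 * basisConst e * r) := mul_le_mul_of_nonneg_right hJ1 h0
      _ = _ := by ring
  have hCrθ : 12 * Real.exp 1 * (1 + Fintype.card J) * basisConst e * (r * θ) ≤ r₂ * θ := by
    rw [hr₂_def]; nlinarith [mul_nonneg (mul_nonneg (mul_nonneg (zero_le_one.trans hJ1) hκ) hr0) hθ0, Real.exp_nonneg (1 : ℝ)]
  have hArθ : 10 * Real.exp 1 * basisConst e * (r * θ) ≤ r₂ * θ := by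
    rw [hr₂_def]
    have h0 : 0 ≤ Real.exp 1 * basisConst e * (r * θ) := by positivity
    nlinarith [mul_le_mul_of_nonneg_right hJ1 h0]
  -- sup row letters (both spacings)
  have hc' : ∀ x' i, ∑ j, |v1coefC e η' U' x' i j| ≤ r₂ := fun x' i =>
    (rowSum_v1coefC_le e hr0 hr2 hη' (hη'η.trans hη1) hs₁ hs₂ hs₃ x' i).trans hCr
  have ha' : ∀ jμ x' i, ∑ j, |v1coefA e η' U' jμ x' i j| ≤ r₂ := fun jμ x' i =>
    (rowSum_v1coefA_le e hr0 hr2 hη' (hη'η.trans hη1) hs₁ hs₂ jμ x' i).trans hAr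
  have hc : ∀ x i, ∑ j, |v1coefC e η (v1avg 𝔄 J π U') x i j| ≤ r₂ := fun x i =>
    (rowSum_v1coefC_le e hr0 hr2 hη0 hη1 hb₁ hb₂ hb₃ x i).trans hCr
  have ha : ∀ jμ x i, ∑ j, |v1coefA e η (v1avg 𝔄 J π U') jμ x i j| ≤ r₂ := fun jμ x i =>
    (rowSum_v1coefA_le e hr0 hr2 hη0 hη1 hb₁ hb₂ jμ x i).trans hAr
  -- row fits
  have hfc : ∀ x' i, ∑ j, |v1coefC e η' U' x' i j - v1coefC e η (v1avg 𝔄 J π U') (π x') i j| ≤ r₂ * θ := fun x' i =>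
    (rowFit_v1coefC e π hr0 hr2 hη' hη'η hη1 hηθ hs₁ hs₂ hb₁ hb₂ hf₁ hf₂ hf₃ x' i).trans hCrθ
  have hfa : ∀ jμ x' i, ∑ j, |v1coefA e η' U' jμ x' i j - v1coefA e η (v1avg 𝔄 J π U') jμ (π x') i j| ≤ r₂ * θ := fun jμ x' i =>
    (rowFit_v1coefA e π hr0 hr2 hη' hη'η hη1 hηθ hs₁ hs₂ hb₁ hb₂ hf₁ hf₂ jμ x' i).trans hArθ
  have hr₂a : r₂ ≤ 16 * Real.exp 1 * (1 + Fintype.card J) * basisConst e * c35 * a₀ := by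
    rw [hr₂_def]
    calc 16 * Real.exp 1 * (1 + Fintype.card J) * basisConst e * r ≤ 16 * Real.exp 1 * (1 + Fintype.card J) * basisConst e * (c35 * a₀) :=
          mul_le_mul_of_nonneg_left hra (by positivity)
      _ = _ := by ring
  refine ⟨hr₂0, hr₂a, hasMaj_unstackM blk hr₂0 hc ha, hasMaj_unstackM (blk ∘ π) hr₂0 hc' ha', ?_⟩
  exact hasMaj_idef_unstackM blk π (mul_nonneg hr₂0 hθ0) hfc hfa

end Letters

end Summit.QuantumFields.YangMills.BalabanUVNodes.N15.BackgroundLayer
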